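import Mathlib
import HarnessLib
import Summits.ValiantsHypothesis.ValiantsHypothesis.Theses.SchenstedIndex
import Summits.ValiantsHypothesis.ValiantsHypothesis.Theorems.SchenstedIndexCountVectors

/-!
# Route SchenstedIndex — crux #2 `OneFactorisationBandLimit` (stmt-ValiantsHypothesis-16081) and its
# calibration rung `BorderPcPerThree` (stmt-ValiantsHypothesis-16085) in COUNT-VECTOR form

By `Theorems/SchenstedIndexCountVectors.lean` (`span_blockCycleVec_rank_le_eq_span_count`), the span
`span_n(t,m)` of the block-cycle vectors of all rank-`≤ n` slot matrices is the ℂ-span of the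
`n^(2|S|)` integer count vectors `v_(X_r)`, `r : S → [n]²`, `X_r(s,s') = [r₁ s = r₂ s']`.  Hence the
two route decls are EQUIVALENT to statements of integer linear algebra about the explicit 0/1
vector `1_OF(t,m)` and these count vectors (`oneFactorisationBandLimit_iff_count`,
`borderPcPerThree_iff_count`) — the form in which exact / modular certificate searches operate.

HONEST FRAMING: equivalences only; both decls remain OPEN; nothing here bears on `VP ≠ VNP`.
-/

set_option linter.dupNamespace false

noncomputable section

namespace Summit.ValiantsHypothesis.ValiantsHypothesis.Theorems.SchenstedIndex

open Matrix

/-- **Crux #2 in count-vector form.** `OneFactorisationBandLimit` (stmt-ValiantsHypothesis-16081)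
is equivalent to the same statement with `span_(m+e)(t,m)` replaced by the span of the count
vectors of the bi-colourings `S → [m+e]²` — a statement of integer linear algebra. -/
theorem oneFactorisationBandLimit_iff_count :
    Summit.ValiantsHypothesis.ValiantsHypothesis.Theses.SchenstedIndex.OneFactorisationBandLimit ↔
    ∀ c m₀ : ℕ, ∃ m : ℕ, m₀ ≤ m ∧ 1 ≤ m ∧ ∀ e : ℕ, m + e ≤ 2 ^ ((Nat.log 2 m + c) ^ c) → ∃ t : ℕ,
      (fun π : {π : Finpartition (Finset.univ : Finset (Fin t × Fin m × Fin m)) //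
          ∀ B ∈ π.parts, B.card = m} =>
        if (∀ B ∈ π.1.parts, (B.image fun s => s.2.1).card = m ∧ (B.image fun s => s.2.2).card = m)
          then (1 : ℂ) else 0) ∉
      Submodule.span ℂ (Set.range fun r : Fin t × Fin m × Fin m → Fin (m + e) × Fin (m + e) =>
        fun π : {π : Finpartition (Finset.univ : Finset (Fin t × Fin m × Fin m)) //
            ∀ B ∈ π.parts, B.card = m} =>
          ∏ B ∈ π.1.parts, ∑ q : Fin m ≃ ↥B, ∏ i : Fin m,
            (Matrix.of fun s s' : Fin t × Fin m × Fin m =>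
              if (r s).1 = (r s').2 then (1 : ℂ) else 0) (q i).1 (q (finRotate m i)).1) := by
  unfold Summit.ValiantsHypothesis.ValiantsHypothesis.Theses.SchenstedIndex.OneFactorisationBandLimit
  simp only [mem_span_rank_le_iff_mem_span_count]

/-- **The calibration rung in count-vector form.** `BorderPcPerThree` (stmt-ValiantsHypothesis-16085)
is equivalent to: for some `t`, the 1-factorisation indicator of `t·K_(3,3)` is not in the span of
the count vectors of the bi-colourings `S → [3]²`. -/
theorem borderPcPerThree_iff_count :
    Summit.ValiantsHypothesis.ValiantsHypothesis.Theses.SchenstedIndex.BorderPcPerThree ↔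
    ∃ t : ℕ,
      (fun π : {π : Finpartition (Finset.univ : Finset (Fin t × Fin 3 × Fin 3)) //
          ∀ B ∈ π.parts, B.card = 3} =>
        if (∀ B ∈ π.1.parts, (B.image fun s => s.2.1).card = 3 ∧ (B.image fun s => s.2.2).card = 3)
          then (1 : ℂ) else 0) ∉
      Submodule.span ℂ (Set.range fun r : Fin t × Fin 3 × Fin 3 → Fin 3 × Fin 3 =>
        fun π : {π : Finpartition (Finset.univ : Finset (Fin t × Fin 3 × Fin 3)) //
            ∀ B ∈ π.parts, B.card = 3} =>
          ∏ B ∈ π.1.parts, ∑ q : Fin 3 ≃ ↥B, ∏ i : Fin 3,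
            (Matrix.of fun s s' : Fin t × Fin 3 × Fin 3 =>
              if (r s).1 = (r s').2 then (1 : ℂ) else 0) (q i).1 (q (finRotate 3 i)).1) := by
  unfold Summit.ValiantsHypothesis.ValiantsHypothesis.Theses.SchenstedIndex.BorderPcPerThree
  simp only [mem_span_rank_le_iff_mem_span_count]

end Summit.ValiantsHypothesis.ValiantsHypothesis.Theorems.SchenstedIndex

end
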